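import Summits.Parity.GeneralizedHardyLittlewood.Theses.LeeYangFibres
import Summits.Parity.GeneralizedHardyLittlewood.Theorems.LeeYangFibresCellsToRelativeDimOneCounts
import Literature.NumberTheory.Sieve.LinearEquationsInPrimesDimOne
import Literature.NumberTheory.Sieve.LinearEquationsInPrimesOneForm
import HarnessLib

/-!
# Crux `PrimeCellsRelative` (stmt-Parity-14112): the containment `K ⊆ [-N, N]` is load-bearing

Negative-side support (refuter cdisprove seat). The count of `PrimeCellsRelative` ranges over the
lattice points of the box `[-N, N]` whose real point lies in `K`, while the main term carries the
archimedean factor `β_∞ = vol(K ∩ {ψᵢ > 0})` of ALL of `K`. Here we record, sorry-free, that the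
hypothesis `K ⊆ realBox 1 N` tying the two together cannot be dropped: the variant without it
(stated inline below; no proposition is defined under `Summits/`) is false at `t = 1` for
`ψ(n) = n` and the convex body `K = [2N, 10N]`, which meets no lattice point of the box (count `0`)
but has `β_∞ = 8N`, so that the model `β_∞ 𝔖 A₁(N)/N = 8 A₁(N) ≍ 8N/log N` exceeds the allowance
`(8A₁(N) + N/log N)/4` (prime number theorem window, tree: `eventually_primeCounting_window`).

Moral for provers: harmless, but it pins the normalisation — `β_∞` must be computed on
`K ∩ [-N, N]`; a proof that enlarges `K` (e.g. to complete a fibre or a translate) must clip it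
back to the box before invoking the crux. This file does NOT refute the crux.
-/

noncomputable section

namespace Summit.Parity.GeneralizedHardyLittlewood.Theorems.PrimeCellsRelative.Negative

open scoped BigOperators Topology Classical MeasureTheory
open Filter Set Function MeasureTheory Finset Literature.NumberTheory.Sieve
open Summit.Parity.GeneralizedHardyLittlewood.Theorems.LeeYangFibresCells
  (card_roughPrimes_le_primeCounting primeCounting_le_card_roughPrimes_add
    eventually_primeCounting_window)

namespace BoxContainment

/-- The archimedean factor of `ψ(n) = n` on `K = [2N, 10N]` is `8N`. [folklore] -/
theorem archFactor_id_farBox (N : ℕ) :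
    archFactor (fun _ : Fin 1 => (⟨fun _ => 1, 0⟩ : AffLinForm 1))
      (Set.Icc (fun _ : Fin 1 => (2 * N : ℝ)) (fun _ => 10 * N)) = 8 * N := by
  rw [DimOne.archFactor_eq]
  rcases Nat.eq_zero_or_pos N with hN | hN
  · subst hN
    have hset : {r : ℝ | (fun _ : Fin 1 => r) ∈ Set.Icc (fun _ : Fin 1 => (2 * (0 : ℕ) : ℝ))
        (fun _ => 10 * (0 : ℕ)) ∧
        ∀ _i : Fin 1, 0 < (⟨fun _ => 1, 0⟩ : AffLinForm 1).realEval (fun _ => r)} = ∅ := by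
      ext r
      simp only [Set.mem_setOf_eq, Set.mem_Icc, Pi.le_def, DimOne.realEval_eq, Int.cast_one,
        one_mul, Int.cast_zero, add_zero, forall_const, Set.mem_empty_iff_false, iff_false,
        not_and, not_lt, Nat.cast_zero, mul_zero]
      rintro ⟨-, h2⟩
      exact h2
    rw [hset]
    simp
  · have hset : {r : ℝ | (fun _ : Fin 1 => r) ∈ Set.Icc (fun _ : Fin 1 => (2 * N : ℝ))
        (fun _ => 10 * N) ∧
        ∀ _i : Fin 1, 0 < (⟨fun _ => 1, 0⟩ : AffLinForm 1).realEval (fun _ => r)} =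
          Set.Icc (2 * N : ℝ) (10 * N) := by
      ext r
      simp only [Set.mem_setOf_eq, Set.mem_Icc, Pi.le_def, DimOne.realEval_eq, Int.cast_one,
        one_mul, Int.cast_zero, add_zero, forall_const]
      have hN' : (0 : ℝ) < N := by exact_mod_cast hN
      constructor
      · rintro ⟨⟨h1, h2⟩, -⟩
        exact ⟨h1, h2⟩
      · rintro ⟨h1, h2⟩
        exact ⟨⟨h1, h2⟩, by linarith⟩
    rw [hset, Real.volume_Icc, ENNReal.toReal_ofReal (by linarith [Nat.cast_nonneg (α := ℝ) N])]
    ring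

/-- The singular product of `ψ(n) = n` is `1`. [folklore] -/
theorem singularProduct_id :
    singularProduct (fun _ : Fin 1 => (⟨fun _ => 1, 0⟩ : AffLinForm 1)) = 1 := by
  rw [OneForm.singularProduct_eq _ (by simp)]
  simp

/-- The arithmetic heart for an EMPTY cell against a main term `c N · 1 · A₁(N)/N`, `c ≥ 1`, with
the two finsets of the statement abstracted (decidability instances met by unification).
[folklore] -/
theorem finish_empty {N : ℕ} (hN : 2 ≤ N) {p : (Fin 1 → ℤ) → Prop} {hdec : DecidablePred p} {A : ℕ}
    {S β Z c : ℝ} (hc : 1 ≤ c)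
    (hb : |(#((latticeBox 1 N).filter p) : ℝ) - β * S * ((A : ℝ) / N) ^ 1| ≤
      1 / 4 * (β * S * ((A : ℝ) / N) ^ 1 + N / Real.log N ^ 1))
    (hnone : ∀ x ∈ latticeBox 1 N, ¬ p x) (hβ : β = c * N) (hS : S = 1)
    (hlow : (Nat.primeCounting N : ℝ) ≤ A + Z) (hZ : Z ≤ Real.sqrt N) (hup : (A : ℝ) ≤ Nat.primeCounting N)
    (hwin : ∀ A' : ℝ, (Nat.primeCounting N : ℝ) - Real.sqrt N ≤ A' → A' ≤ Nat.primeCounting N →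
      (1 - 1 / 2) * N ≤ A' * Real.log N ∧ A' * Real.log N ≤ (1 + 1 / 2) * N) : False := by
  have hcount : (#((latticeBox 1 N).filter p) : ℝ) = 0 := by
    rw [Nat.cast_eq_zero, Finset.card_eq_zero, Finset.filter_eq_empty_iff]
    exact hnone
  rw [hcount, hβ, hS, pow_one, pow_one] at hb
  have hN0 : (0 : ℝ) < N := by exact_mod_cast (show 0 < N by omega)
  have hlog : 0 < Real.log N := Real.log_pos (by exact_mod_cast (show 1 < N by omega))
  have h2 : c * (N : ℝ) * 1 * ((A : ℝ) / N) = c * A := by field_simp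
  rw [h2, zero_sub, abs_neg, abs_of_nonneg (by positivity)] at hb
  -- `3 c A ≤ N / log N`
  have h6 : 3 * c * (A : ℝ) * Real.log N ≤ N := by
    have h' : 3 * c * (A : ℝ) ≤ N / Real.log N := by linarith
    have := mul_le_mul_of_nonneg_right h' hlog.le
    rwa [div_mul_cancel₀ _ hlog.ne'] at this
  -- the prime number theorem window: `N/2 ≤ A log N`
  have hw := (hwin A (by linarith) hup).1
  have hA : (A : ℝ) * Real.log N ≤ c * ((A : ℝ) * Real.log N) :=
    le_mul_of_one_le_left (by positivity) hc
  nlinarith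

end BoxContainment

open BoxContainment in
/-- **The hypothesis `K ⊆ [-N, N]` of `PrimeCellsRelative` cannot be dropped.** Without it, at
`t = 1`, `L = 1`, `ε = 1/4`, the system `ψ(n) = n` (`𝔖 = 1`) and the convex body `K = [2N, 10N]`
give an empty count (no lattice point of `[-N, N]` lies in `K`) against the model
`β_∞ 𝔖 A₁(N)/N = 8 A₁(N)`, and `8 A₁ ≤ (8 A₁ + N/log N)/4` contradicts `A₁(N) log N ≥ N/2`.
[folklore] -/
theorem primeCellsRelative_false_without_boxContainment :
    ¬ (∀ (t L : ℕ), 1 ≤ t → ∀ ε : ℝ, 0 < ε → ∃ u : ℕ, 2 ≤ u ∧ ∃ N₀ : ℕ, ∀ N : ℕ, N₀ ≤ N →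
      ∀ Ψ : Fin t → Literature.NumberTheory.Sieve.AffLinForm 1,
        Literature.NumberTheory.Sieve.IsNondegenerateSystem Ψ →
        Literature.NumberTheory.Sieve.affLinSize Ψ N ≤ L →
        ∀ K : Set (Fin 1 → ℝ), Convex ℝ K →
          |((((Literature.NumberTheory.Sieve.latticeBox 1 N).filter (fun n =>
              Literature.NumberTheory.Sieve.realPoint n ∈ K ∧ ∀ i, (N : ℝ) ^ ((1 : ℝ) / u) <
                (Nat.minFac ((Ψ i).eval n).toNat : ℝ) ∧
                ArithmeticFunction.cardFactors ((Ψ i).eval n).toNat = 1)).card : ℕ) : ℝ) -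
            Literature.NumberTheory.Sieve.archFactor Ψ K *
              Literature.NumberTheory.Sieve.singularProduct Ψ *
              (((((Finset.Icc 1 N).filter (fun m => (N : ℝ) ^ ((1 : ℝ) / u) < (Nat.minFac m : ℝ) ∧
                ArithmeticFunction.cardFactors m = 1)).card : ℕ) : ℝ) / N) ^ t| ≤
          ε * (Literature.NumberTheory.Sieve.archFactor Ψ K *
              Literature.NumberTheory.Sieve.singularProduct Ψ *
              (((((Finset.Icc 1 N).filter (fun m => (N : ℝ) ^ ((1 : ℝ) / u) < (Nat.minFac m : ℝ) ∧
                ArithmeticFunction.cardFactors m = 1)).card : ℕ) : ℝ) / N) ^ t + N / Real.log N ^ t)) := by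
  intro h
  obtain ⟨u, hu2, N₀, hN₀⟩ := h 1 1 le_rfl (1 / 4) (by norm_num)
  obtain ⟨N₁, hN₁⟩ := Filter.eventually_atTop.mp
    (eventually_primeCounting_window (η := 1 / 2) (by norm_num))
  set N : ℕ := max (max N₀ N₁) 2 with hNdef
  have hN₀N : N₀ ≤ N := (le_max_left _ _).trans (le_max_left _ _)
  have hN₁N : N₁ ≤ N := (le_max_right _ _).trans (le_max_left _ _)
  have hN2 : 2 ≤ N := le_max_right _ _
  have hb := hN₀ N hN₀N (fun _ => ⟨fun _ => 1, 0⟩) ?_ ?_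
    (Set.Icc (fun _ : Fin 1 => (2 * N : ℝ)) (fun _ => 10 * N)) (convex_Icc _ _)
  · refine finish_empty hN2 (by norm_num : (1 : ℝ) ≤ 8) hb (fun x hx hpx => ?_) (archFactor_id_farBox N)
      singularProduct_id
      (primeCounting_le_card_roughPrimes_add N (Real.rpow_nonneg (Nat.cast_nonneg N) _)) ?_
      (card_roughPrimes_le_primeCounting N _) (hN₁ N hN₁N)
    · -- no lattice point of `[-N, N]` lies in `[2N, 10N]`
      obtain ⟨hK, -⟩ := hpx
      have hx0 : x 0 ≤ (N : ℤ) := by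
        have := Fintype.mem_piFinset.mp hx 0
        exact (Finset.mem_Icc.mp this).2
      have hK0 := (Set.mem_Icc.mp hK).1 0
      simp only [Literature.NumberTheory.Sieve.realPoint] at hK0
      have h1 : ((x 0 : ℤ) : ℝ) ≤ (N : ℝ) := by exact_mod_cast hx0
      have h2 : (1 : ℝ) ≤ N := by exact_mod_cast (show 1 ≤ N by omega)
      linarith
    · -- `N^{1/u} ≤ √N`
      have hN1 : (1 : ℝ) ≤ (N : ℝ) := by exact_mod_cast (show 1 ≤ N by omega)
      have hu : (1 : ℝ) / u ≤ 1 / 2 := by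
        gcongr
        exact_mod_cast hu2
      calc (N : ℝ) ^ ((1 : ℝ) / u) ≤ (N : ℝ) ^ ((1 : ℝ) / 2) := Real.rpow_le_rpow_of_exponent_le hN1 hu
        _ = Real.sqrt N := by rw [Real.sqrt_eq_rpow]
  · refine ⟨fun i h0 => ?_, fun i j hij => absurd (Subsingleton.elim i j) hij⟩
    have := congr_fun h0 0
    simp at this
  · simp [Literature.NumberTheory.Sieve.affLinSize]

end Summit.Parity.GeneralizedHardyLittlewood.Theorems.PrimeCellsRelative.Negative

end
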